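import Summits.ResolutionOfSingularities.ResolutionOfSingularities.Theorems.PurelyInseparableDim4ChartClosureSNC
import Summits.ResolutionOfSingularities.ResolutionOfSingularities.Theorems.PurelyInseparableDim4ChartClosureSupport
import HarnessLib

/-!
# Purely inseparable four-folds `z^p + F(x₁, …, x₄)`: the global centre of an ARBITRARY next coordinate centre
# outside the new exceptional divisor is an ADMISSIBLE centre — the S3-glob package at depth 2, case `j ∉ S'`
# (brick S3-glob, part D3; cell `res-dim4-pi`, typ-2 g4)

[OURS · counted 0] (D-0157 DOOR 2; DR-157-C; desk WORD #97 (c): «write the S3-glob depth-2 question as a Lean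
SIGNATURE … or the exact shape you find honest»; frame `PIDim4.TerminationImpliesOrderReduction`, S3 (c)).
ASSEMBLY of B2 (Q1), D1 (Q2), D2 (Q3) on the walk's own data, in the shape typ-3's joint forest consumes
(`…JointChild.coord_child_package`): for a presented state `s`, a Hironaka-permissible coordinate centre `S ∋ j`
(`p ≤ ord_{(x_S)} s.F`), ANY blowing up `π : W → 𝔸⁵_K` along `V(z, x_S)`, a point `b` of the exceptional
hyperplane of the `x_j`-chart (`b_j = 0`) and ANY next coordinate centre `S'` with `j ∉ S'` permissible for the
stepped state `step p S j b s` — in particular an ESCAPING one, `S ∖ {j} ⊄ S'`, whose chart image is NOT closed in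
`W` (`…ChartCentreEscape`, `…ChartEscapeInstance`) —

* **`globalCentre_admissible_package_of_not_mem`**: there is a re-centring `Θ` of the chart (`Θ z = z + h(x)`,
  `Θ xᵢ = xᵢ + bᵢ`; translation followed by the dictionary's cleaning) such that, with
  `φ = Spec Θ ≫ chartImm_j`, `Zc = 𝓘(closure φ(V(z, x_{S'})))` and `M' = ((z^p + s.F)·𝒪, [], p).transform π 𝓘Λ_S`:
  `φ` reads `M'` as `(z^p + (step p S j b s).F)·𝒪` and `Zc` as `𝓘Λ_{S'}`, and `Zc` is an ADMISSIBLE BGMW centre on `W`: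
  `Zc.subscheme` REGULAR (Q1), `V(Zc) ⊆ supp M'` (Q2), `HasSNCWith M'.boundary Zc` (Q3, boundary `[E₁]`).

HONEST SCOPE. `K` algebraically closed of characteristic `p` (perfectness is what Q2 uses; the cleaning needs `p`-th
roots). Depth 2 from the root (boundary `[E₁]`). The case `j ∈ S'` (next centre inside `E₁`: its closure is a
projective-linear sub-bundle of `E₁`) is NOT covered here. Nothing is said about the walk over the points
`closure ∖ image` (other charts), nor about termination; resolution of singularities in dimension ≥ 4 /
characteristic `p` is NOT proved anywhere in this programme. bears_on: LADDER-RESOLUTION:D157-DOOR2 (res-dim4-pi).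
Supports stmt-ResolutionOfSingularities-16155 (helper, S3-glob D3).
-/

-- every declaration of this summit lives under `Summit.ResolutionOfSingularities.ResolutionOfSingularities`
-- (summit = problem), which the duplicate-namespace linter flags; house convention (cf. the Target file).
set_option linter.dupNamespace false

noncomputable section

open MvPolynomial Finset CategoryTheory AlgebraicGeometry Opposite TopologicalSpace
open AlgebraicGeometry.Scheme.IdealSheafData (ofIdealTop vanishingIdeal)

namespace Summit.ResolutionOfSingularities.ResolutionOfSingularities.Theorems.PIDim4

open Literature.AlgebraicGeometry.Resolution
open Literature.AlgebraicGeometry.Resolution.AffinePointBlowup (P A γ coord Wtop ξ)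

namespace ChartDictionary

variable {K : Type} [Field K] {p : ℕ} [hp : Fact p.Prime] [CharP K p]
  {S S' : Finset (Fin 4)} {j : Fin 4} {b : Fin 4 → K} {W : Scheme.{0}} {π : W ⟶ P 4 K}

/-- **THE S3-GLOB PACKAGE AT DEPTH 2, case `j ∉ S'`** — see the module docstring. -/
theorem globalCentre_admissible_package_of_not_mem [IsAlgClosed K] [DecidableEq K] (hj : j ∈ S) (hjS' : j ∉ S')
    (hbj : b j = 0) (s : State K) (hperm : (p : ℕ∞) ≤ CentreBlowup.ordAlong S s.F)
    (hπ : IsBlowup π (AffineCoordBlowup.𝓘Λ 4 K (insert 0 (Fin.succ '' (S : Set (Fin 4))))))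
    (hperm' : (p : ℕ∞) ≤ CentreBlowup.ordAlong S' (CentreBlowup.step p S j b s).F) :
    ∃ (Θ : A 4 K ≃ₐ[K] A 4 K) (h : MvPolynomial (Fin 4) K) (_ : IsIso (CommRingCat.ofHom (Θ : A 4 K →+* A 4 K))),
      Θ (X 0) = X 0 + rename Fin.succ h ∧ (∀ i : Fin 4, Θ (X i.succ) = X i.succ + C (b i)) ∧
      let φ := Spec.map (CommRingCat.ofHom (Θ : A 4 K →+* A 4 K)) ≫ AffineCoordBlowup.chartImm hπ (succ_mem_centreVars hj)
      let Zc := vanishingIdeal (closureImage φ ((AffineCoordBlowup.𝓘Λ 4 K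
        (insert 0 (Fin.succ '' (S' : Set (Fin 4))))).support : Set (P 4 K)))
      let M' := ((⟨hypSheaf p s.F, [], p⟩ : MarkedIdeal (P 4 K)).transform π
        (AffineCoordBlowup.𝓘Λ 4 K (insert 0 (Fin.succ '' (S : Set (Fin 4))))))
      M'.ideal.comap φ = hypSheaf p (CentreBlowup.step p S j b s).F ∧
      Zc.comap φ = AffineCoordBlowup.𝓘Λ 4 K (insert 0 (Fin.succ '' (S' : Set (Fin 4)))) ∧
      Scheme.IsRegular Zc.subscheme ∧ (Zc.support : Set W) ⊆ M'.support ∧ HasSNCWith M'.boundary Zc := by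
  haveI : PerfectRing K p := PerfectRing.ofSurjective K p fun x => IsAlgClosed.exists_pow_nat_eq x hp.out.pos
  obtain ⟨θ, h, h0, hs, h1, -⟩ := exists_clean_translate_hyp_eq_step p hj hbj s hperm
  -- the re-centring of record: translation by `b`, then cleaning by `h`
  let Θ : A 4 K ≃ₐ[K] A 4 K := (AffinePointBlowup.translateEquiv (Fin.cases 0 b)).trans θ
  have hΘ0 : Θ (X 0) = X 0 + rename Fin.succ h := by
    change θ (AffinePointBlowup.translateEquiv (Fin.cases 0 b) (X 0)) = _
    rw [AffinePointBlowup.translateEquiv_X, Fin.cases_zero, C_0, add_zero, h0]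
  have hΘs : ∀ i : Fin 4, Θ (X i.succ) = X i.succ + C (b i) := fun i => by
    change θ (AffinePointBlowup.translateEquiv (Fin.cases 0 b) (X i.succ)) = _
    rw [AffinePointBlowup.translateEquiv_X, Fin.cases_succ, map_add, hs]
    exact congrArg _ (θ.commutes (b i))
  have hread : Θ (coordBlowupSubst K (insert 0 (Fin.succ '' (S : Set (Fin 4)))) j.succ (hyp p s.F)) =
      X j.succ ^ p * hyp p (CentreBlowup.step p S j b s).F := by
    change θ (AffinePointBlowup.translateEquiv (Fin.cases 0 b) _) = _
    rw [← h1]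
    rfl
  haveI hiso : IsIso (CommRingCat.ofHom (Θ : A 4 K →+* A 4 K)) :=
    (inferInstance : IsIso Θ.toRingEquiv.toCommRingCatIso.hom)
  refine ⟨Θ, h, hiso, hΘ0, hΘs, ?_, ?_, ?_, ?_, ?_⟩
  · exact comap_chart_transform_ideal_of_reading hj hbj hΘ0 hΘs hπ hperm hread _ rfl rfl
  · exact comap_globalCentre _ _
  · exact isRegular_globalCentre_of_reading_of_not_mem hj hjS' hbj hΘ0 hΘs hπ hperm hread hperm'
  · exact support_globalCentre_subset_support_transform hj hbj hΘ0 hΘs hπ hperm hread hperm'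
  · exact hasSNCWith_transform_boundary_globalCentre_of_not_mem hj hjS' hbj hΘ0 hΘs hπ hperm hread hperm'

end ChartDictionary

end Summit.ResolutionOfSingularities.ResolutionOfSingularities.Theorems.PIDim4

end
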